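import Literature.NumberTheory.Sieve.ParityWave0
import Literature.NumberTheory.Sieve.ParityWave0Proofs
import Literature.NumberTheory.Sieve.MontgomeryVaughan1975
import Literature.NumberTheory.Sieve.MontgomeryVaughan1975MinorArcs
import Literature.NumberTheory.Sieve.VinogradovExpSum
import HarnessLib

/-!
# Lu (2010): the exceptional set of Goldbach numbers is `≪ x^{0.879}`

The circle-method reduction of Lu's theorem to its major-arc half: the minor-arc input is
PROVED, the assembly is PROVED, and the major-arc input enters as the explicit hypothesis
`MajorArcLowerBoundOffSmallSet 0.879` — a `σ`-indexed predicate, not a named fact of its own (it is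
the whole depth of Lu's paper; see `## What remains`).

Target named fact: `Literature.NumberTheory.Sieve.goldbachExceptionalCount_isBigO_rpow_lu` (parity.S15,
`Literature/NumberTheory/Sieve/ParityWave0.lean`):
`E(x) = #{N ≤ x : N even, N ≥ 4, N ≠ p + p'} ≪ x^{0.879}`, which is

* W. C. Lu, *Exceptional set of Goldbach number*, J. Number Theory **130** (2010) 2359–2392
  [LuJNT2010], Theorem 1: `E(x) ≪ x^{0.879}`. Quoted in print by Pintz, arXiv:1804.05561, p. 2
  ("improved further by Wen Chao Lu in 2010 to `E(X) < X^{0.879}` for `X > X₂`, an ineffective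
  constant") [Pintz2018ExplicitFormulaI]. Lu's `E` counts all even `n ≤ x` that are not a sum of
  two primes; H21's `goldbachExceptionalCount` omits `n = 0, 2`, a difference of at most `2 = O(1)`.

The printed proof is a whole theory — the Hardy–Littlewood circle method with major arcs of level
`P = x^θ`, `θ` a fixed constant near `0.121`, whose treatment needs log-free zero-density estimates
for Dirichlet `L`-functions, explicit zero-free regions and the Deuring–Heilbronn phenomenon
(Lu's reference list: Chen–Pan 1980, Li 1999/2000, Jutila 1977, Huxley 1975, Heath-Brown 1992,
Montgomery–Vaughan 1975). None of these inputs is in Mathlib. This file does for Lu's exponent what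
`Literature/NumberTheory/Sieve/MontgomeryVaughan1975.lean` does for Montgomery–Vaughan's
`x^{1-δ}`: it fixes the objects, names the two analytic inputs, and PROVES everything above them.

## Architecture (Montgomery–Vaughan 1975 §8; Li, Acta Arith. 92 (2000) §4 and §6 [Li2000])

With `S(α) = ∑_{P < p ≤ X} (log p) e(pα)`, `P = X^θ`, `Q = X^{1-θ}`, major arcs
`𝔐 = ⋃_{q ≤ P} ⋃_{(a,q)=1} [a/q - 1/(qQ), a/q + 1/(qQ)]`, minor arcs `𝔪 = [Q⁻¹, 1 + Q⁻¹] ∖ 𝔐`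
(the objects `Literature.MontgomeryVaughan1975.expSum/majorArcs/minorArcs`; Li 2000 §4 p. 81 uses the
same dissection with `Y = x^λ` in place of `P` and calls the two pieces `D₁(n)`, `D₂(n)`):

* `R(n) = R₁(n) + R₂(n)` ((3.1) of M–V; (4.2) of Li), `R₁ = ∫_𝔐 S² e(-nα)`, `R₂ = ∫_𝔪 S² e(-nα)`,
  and `R(n) > 0 ⇒ n = p₁ + p₂` — proved in `MontgomeryVaughan1975` (`coeffR_eq_add`,
  `coeffR_pos_of_lt`, `goldbachCount_ne_zero_of_coeffR_ne_zero`).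
* MINOR ARCS (input A, `minorArc_meanSquare_of_level`): `∑_{n ≤ X} |R₂(n)|² ≤ X^{3-θ+η}` for
  every level `0 < θ ≤ 1/4`, every `η > 0` and `X ≥ X₀(θ, η)`. Printed route: Bessel's inequality
  `∑_n |R₂(n)|² ≤ ∫_𝔪 |S|⁴` (Vaughan, *The Hardy–Littlewood Method* (1981), (3.20)) and
  `sup_𝔪 |S| ≪ X P^{-1/2} (log X)⁴` from Vinogradov's estimate in Vaughan's form (Vaughan, Thm 3.1
  = `Literature.NumberTheory.Sieve.MontgomeryVaughan1975.vinogradov_expSum_bound`) via Dirichlet's approximation theorem,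
  exactly as in (3.2)–(3.3) of Montgomery–Vaughan; Li 2000, Lemma 7 (p. 81) is the instance
  `λ = 0.0862` in counted form. By Chebyshev's inequality A bounds the number of `n ≤ X` with
  `|R₂(n)| > X^{1-κ}` by `X^{1-θ+2κ+η}` (`card_filter_lt_norm_le_of_sum_sq_le`). A is DISCHARGED
  here: relative to `vinogradov_expSum_bound` (`minorArc_meanSquare_of_level_of_vinogradov`), from
  (3.3) and Bessel's inequality as proved in
  `Literature/NumberTheory/Sieve/MontgomeryVaughan1975MinorArcs.lean`, and then outright
  (`minorArc_meanSquare_of_level_holds`), Vinogradov's estimate being proved in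
  `Literature/NumberTheory/Sieve/VinogradovExpSum.lean`
  (`Literature.NumberTheory.Sieve.Vinogradov.vinogradov_primeExpSumLog_bound`, Nathanson, GTM 164, Thm 8.5).
* MAJOR ARCS (input B, the hypothesis `MajorArcLowerBoundOffSmallSet σ`; Lu's theorem is the case
  `σ = 0.879`): for some window parameter `ε`, level `θ` and saving `κ` with
  `1 - θ + 2κ < σ`, `Re R₁(n) > X^{1-κ}` for all even `n ∈ ((1-ε)X, X]` with at most `C X^σ`
  exceptions, `X ≥ X₀`. This is the deep half (Li 2000 §6, (6.1)–(6.7) with `λ = 0.0862`, giving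
  `σ = 0.914`; Lu 2010 reaches `σ = 0.879`), resting on the zero-density estimates and the
  Deuring–Heilbronn phenomenon; it is NOT proved here.
* ASSEMBLY (proved here): A ∧ B(σ) ⇒ at most `C' X^σ` even `n ∈ ((1-ε)X, X]` are not sums of two
  primes (`card_exceptionalWindow_le_of_arcs`) ⇒ `E(x) ≤ E(⌊(1-ε)x⌋) + C' x^σ` ⇒ `E(x) ≪ x^σ`
  (geometric summation over the windows `((1-ε)^{k+1} x, (1-ε)^k x]`, `le_mul_rpow_of_contraction`)
  ⇒ for `σ = 0.879`, `Literature.NumberTheory.Sieve.goldbachExceptionalCount_isBigO_rpow_lu`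
  (`Literature.NumberTheory.Sieve.goldbachExceptionalCount_isBigO_rpow_lu_of_arcs`).

## What remains

The one named fact of this story is parity.S15 itself,
`Literature.NumberTheory.Sieve.goldbachExceptionalCount_isBigO_rpow_lu` (Lu's Theorem 1 as
printed), and what remains for `goldbachExceptionalCount_isBigO_rpow_lu_holds` is input B at
`σ = 0.879`, i.e. a proof of `MajorArcLowerBoundOffSmallSet 0.879` (Lu's paper proper), to be fed to
`goldbachExceptionalCount_isBigO_rpow_lu_of_majorArc`; more generally
`MajorArcLowerBoundOffSmallSet σ → E(x) ≪ x^σ` unconditionally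
(`goldbachExceptionalCount_isBigO_rpow_of_majorArc`). Input B is deliberately NOT vendored as a
named fact `def … : Prop` citing Lu: it is not a statement printed in [LuJNT2010] (whose text is
not held, see `## Source status`) but the interface consumed by the counting argument, and by
`Literature.NumberTheory.Sieve.Lu2010.majorArcLowerBoundOffSmallSet_iff_goldbachCount`
(`Literature/NumberTheory/Sieve/LuGoldbachExceptionalSetProofs.lean`, proved) it is EQUIVALENT to
Lu's theorem in quantitative form — there are `0 < ε ≤ 1/2` and `κ > 0` with `3/4 + 2κ < 0.879`
such that for `X ≥ X₀` all even `n ∈ ((1-ε)X, X]` except at most `C X^{0.879}` of them have more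
than `X^{1-κ}` ordered Goldbach representations — so that as a separate fact it would merely
restate the parent in stronger words (D-0026/D-0027: facts do not decompose).

**What input B at `σ = 0.879` rests on** (for whoever discharges parity.S15) — the one deep input,
absent from Mathlib and from the tree (whose Montgomery–Vaughan 1975 cluster is the inexplicit
level `X^{6δ}`): in Li's treatment [Li2000], which Lu's refines with sharper constants, the
major-arc error is governed through the explicit formula and Gallagher's lemma by
`W(Y) = ∑_{d≤Y} ∑*_{χ mod d} W(χ_d)`,
`W(χ_d) = (∫_{|θ|≤1/(dQ)} |W(θ, χ_d)|² dθ)^{1/2} ≤ (1 + 2·10⁻⁵) x^{1/2} ∑'_{β≥1/4, |γ|≤Y^{1+ε}/d}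
x^{(1-ε)(β-1)} + O(x^{1/2-0.01λ})` (Li (4.14)–(4.16), (5.1), pp. 82–83), and the zero sum
`∑_{d≤x^λ} ∑*_χ ∑_ρ x^{β-1}` over all primitive characters to moduli `≤ x^λ` must be bounded by
small ABSOLUTE constants (Li (5.5)–(5.14) against the margins `8`, `2.0797`, `4.1594` of
(4.15)–(4.19), constants of Chen–Pan, Sci. Sinica 23 (1980)): explicit-constant log-free
zero-density estimates near `σ = 1` (Li §3, Lemma 6), explicit zero-free regions with at most two
or three zeros near `1` (Li §2, Lemmas 1–5 and tables, after Heath-Brown, Proc. London Math.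
Soc. 64 (1992), Lemmas 8.3, 9.1) and the Deuring–Heilbronn phenomenon in the exceptional case
(Li Lemmas 8–9); Li's instance is `λ = 0.0862`: `D₁(n) ≥ 0.6 x^{1-10⁻⁵λ}` for every even
`n ∈ [(1-ε)x, x]` apart from `≪ x^{1-(1-10⁻⁴)λ+ε}` of them (§6, (6.1)–(6.7), pp. 86–88; major-arc
exceptions occur only through `(n, q̃) > x^{(1-10⁻⁴)λ}` for an exceptional modulus `q̃`, (6.3)),
and Lemma 7 (p. 81) bounds the `n` with `|D₂(n)| > 0.5 x^{1-10⁻⁵λ}` by `≪ x^{1-(1-10⁻⁴)λ}`, whence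
`E(x) = O(x^{0.914})` (Li's Theorem, p. 71). Lu 2010 reaches `0.879` ("improved to `δ = 0.086` by
H. Z. Li and `δ = 0.121` by W. C. Lu" in `E(x) ≪ x^{1-δ}`, Zhao, arXiv:2511.05631, §1
[Zhao2025GoldbachLinnik]; "`E(X) < X^{0.879}` for `X > X₂`, an ineffective constant", Pintz,
arXiv:1804.05561, p. 2 — Siegel's theorem enters in the exceptional case).

## Source status

Lu's paper is not held by the literature store at the time of writing (acquisition request
acq-00423, doi:10.1016/j.jnt.2010.03.017; no open copy, and the secondary literature only quotes
the statement of Theorem 1); its statement is taken from the vendored fact parity.S15 and from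
Pintz's quotation, its architecture from its own reference list (zbMATH 1261.11067) and from
Li 2000 [Li2000], which is held and on which it builds. Input B is therefore recorded, as a
hypothesis, in the currency of the Montgomery–Vaughan objects and in the window/threshold form
consumed by the counting argument, with the window ratio `1 - ε`, the level `θ` and the saving `κ`
existentially quantified, so that it is implied by any instance of the method (Li's `λ = 0.0862`,
thresholds `0.5 x^{1-10⁻⁵λ}`, exception count `x^{1-(1-10⁻⁴)λ+ε}` on `[(1-ε)x, x]` is one such
instance at `σ = 0.914`), and indeed by any power-saving lower bound for the number of Goldbach
representations off `≪ X^σ` exceptions, whatever the arcs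
(`majorArcLowerBoundOffSmallSet_iff_goldbachCount`).

## Design choices

* Level `θ ≤ 1/4` throughout, so that `P + 1 ≤ Q` (`rpow_add_one_le_rpow_one_sub`) and (3.1) is
  available verbatim from `MontgomeryVaughan1975`; all published instances have `θ < 0.13`.
* Input A is stated with an `X^η` loss instead of the printed power of `log X`: weaker than what
  the printed argument gives, and all that the assembly uses.
* The window is `((1-ε)X, X]` with `0 < ε ≤ 1/2` (Li, Lu: `[(1-ε)x, x]`; M–V: `(X/2, X]`).
-/

noncomputable section

open Filter Asymptotics Finset MeasureTheory

namespace Literature.NumberTheory.Sieve.Lu2010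

open MontgomeryVaughan1975

/-! ### The window and the two inputs -/

/-- The set counted by the method: even `n` with `(1-ε)X < n ≤ X` that are not a sum of two primes
(`goldbachCount n = 0`) (Li 2000, §4, Lemma 7 and §6: `n ∈ [(1-ε)x, x]`; Montgomery–Vaughan 1975
(8.2) with `ε = 1/2`). This is the window of `Literature.NumberTheory.Sieve.MontgomeryVaughan1975.exceptionalWindow` with the
ratio `1/2` replaced by the parameter `1 - ε` (`exceptionalWindow_half`:
`MontgomeryVaughan1975.exceptionalWindow X = exceptionalWindow (1/2) X`); inside this file the
two-argument form is always meant. [cite: Li2000, §4 Lemma 7] -/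
def exceptionalWindow (ε X : ℝ) : Finset ℕ :=
  (Finset.Icc 1 ⌊X⌋₊).filter fun n : ℕ =>
    (1 - ε) * X < n ∧ Even n ∧ Literature.NumberTheory.Sieve.ParityWave0.goldbachCount n = 0

/-- Bridge to Montgomery–Vaughan's window `(X/2, X]`: it is the case `ε = 1/2`.
[cite: MontgomeryVaughanActa1975, §8 (8.2)] -/
theorem exceptionalWindow_half (X : ℝ) :
    Literature.NumberTheory.Sieve.MontgomeryVaughan1975.exceptionalWindow X = exceptionalWindow (1 / 2) X := by
  unfold Literature.NumberTheory.Sieve.MontgomeryVaughan1975.exceptionalWindow exceptionalWindow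
  refine Finset.filter_congr fun n _ => ?_
  rw [show (1 - 1 / 2) * X = X / 2 by ring]

/-- NAMED FACT A — **minor-arc mean square at level `θ`**: for `0 < θ ≤ 1/4`, `η > 0` and
`X ≥ X₀(θ, η)`, with `P = X^θ`, `Q = X^{1-θ}` and `R₂(n) = ∫_𝔪 S(α)² e(-nα) dα`,
`∑_{n ≤ X} |R₂(n)|² ≤ X^{3-θ+η}`. Printed route (giving the sharper `≪ X^{3-θ} (log X)⁹`):
Bessel's inequality `∑ₙ |R₂(n)|² ≤ ∫_𝔪 |S(α)|⁴ dα ≤ (sup_𝔪 |S|)² ∑_{p ≤ X} (log p)²` (Vaughan,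
*The Hardy–Littlewood Method* (1981), §3.2 (3.20), p. 22) and `sup_𝔪 |S| ≪ X P^{-1/2} (log X)⁴` from
Vaughan's Theorem 3.1 (= `Literature.NumberTheory.Sieve.MontgomeryVaughan1975.vinogradov_expSum_bound`, Nathanson Thm 8.5)
with Dirichlet's theorem (`q ≤ Q`, and `q > P` off `𝔐`), as in Montgomery–Vaughan 1975,
(3.2)–(3.3); the counted instance `λ = 0.0862` is Li 2000, Lemma 7 (p. 81). Not in Mathlib;
discharged below relative to `vinogradov_expSum_bound`
(`minorArc_meanSquare_of_level_of_vinogradov`).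
[cite: VaughanHL1981, §3.2 (3.20) p. 22; Theorem 3.1 p. 19] -/
def minorArc_meanSquare_of_level : Prop :=
  ∀ θ : ℝ, 0 < θ → θ ≤ 1 / 4 → ∀ η : ℝ, 0 < η → ∃ X₀ : ℝ, ∀ X : ℝ, X₀ ≤ X →
    ∑ n ∈ Finset.Icc 1 ⌊X⌋₊, ‖minorArcIntegral (X ^ θ) (X ^ (1 - θ)) X n‖ ^ 2 ≤ X ^ (3 - θ + η)

/-- INPUT B(σ), a hypothesis — **major-arc lower bound off a small exceptional set, at exponent
`σ`** (the output of the major-arc analysis in the Chen–Pan / Li / Lu treatment of the exceptional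
set, in the form consumed by the counting argument of Montgomery–Vaughan 1975 §8; a `σ`-indexed
predicate used as the hypothesis of the assembly theorems below, true content `3/4 < σ < 1`, and at
`σ = 0.879` the whole depth of Lu 2010 [LuJNT2010] — see the module docstring, `## What remains`):
there are a window ratio `1 - ε`
(`0 < ε ≤ 1/2`), a level `0 < θ ≤ 1/4` and a saving `κ > 0` with `1 - θ + 2κ < σ`, such that for
`X ≥ X₀`, with `P = X^θ`, `Q = X^{1-θ}`, `R₁(n) = ∫_𝔐 S(α)² e(-nα) dα`, the number of even
`n ∈ ((1-ε)X, X]` with `Re R₁(n) ≤ X^{1-κ}` is at most `C X^σ`. Li 2000 §6 ((6.1)–(6.7), with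
Lemma 7 and `Y = x^λ`, `λ = 0.0862`) is the instance `σ = 0.914`: `D₁(n) ≥ 0.6 x^{1-10⁻⁵λ}` for all
even `n ∈ [(1-ε)x, x]` outside a set of size `≪ x^{1-(1-10⁻⁴)λ+ε}`.
[cite: Li2000, §6 (6.1)–(6.7) and Lemma 7, pp. 81, 88] -/
def MajorArcLowerBoundOffSmallSet (σ : ℝ) : Prop :=
  ∃ ε θ κ : ℝ, 0 < ε ∧ ε ≤ 1 / 2 ∧ 0 < θ ∧ θ ≤ 1 / 4 ∧ 0 < κ ∧ 1 - θ + 2 * κ < σ ∧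
    ∃ C X₀ : ℝ, ∀ X : ℝ, X₀ ≤ X →
      (((Finset.Icc 1 ⌊X⌋₊).filter fun n : ℕ => (1 - ε) * X < n ∧ Even n ∧
          (majorArcIntegral (X ^ θ) (X ^ (1 - θ)) X n).re ≤ X ^ (1 - κ)).card : ℝ) ≤
        C * X ^ σ

/-! ### Chebyshev's inequality on input A -/

/-- From the mean square to a count (Chebyshev / Markov): if `∑_{n ≤ X} |R₂(n)|² ≤ X^{3-θ+η}` then
at most `X^{1-θ+2κ+η}` integers `n ≤ X` have `|R₂(n)| > X^{1-κ}` (Montgomery–Vaughan 1975, §8,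
first display of p. 367; Li 2000, Lemma 7). [cite: MontgomeryVaughanActa1975, §8 (8.2)] -/
theorem card_filter_lt_norm_le_of_sum_sq_le {X θ η κ : ℝ} (hX : 0 < X) {R₂ : ℕ → ℂ}
    (h : ∑ n ∈ Finset.Icc 1 ⌊X⌋₊, ‖R₂ n‖ ^ 2 ≤ X ^ (3 - θ + η)) :
    (((Finset.Icc 1 ⌊X⌋₊).filter fun n : ℕ => X ^ (1 - κ) < ‖R₂ n‖).card : ℝ) ≤
      X ^ (1 - θ + 2 * κ + η) := by
  set B₁ : Finset ℕ := (Finset.Icc 1 ⌊X⌋₊).filter fun n : ℕ => X ^ (1 - κ) < ‖R₂ n‖ with hB₁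
  have hT : 0 < X ^ (1 - κ) := Real.rpow_pos_of_pos hX _
  have hcheb : (B₁.card : ℝ) * (X ^ (1 - κ)) ^ 2 ≤ ∑ n ∈ B₁, ‖R₂ n‖ ^ 2 := by
    rw [← nsmul_eq_mul]
    refine Finset.card_nsmul_le_sum B₁ (fun n => ‖R₂ n‖ ^ 2) _ fun n hn => ?_
    have hlt : X ^ (1 - κ) < ‖R₂ n‖ := (Finset.mem_filter.mp hn).2
    exact pow_le_pow_left₀ hT.le hlt.le 2
  have hmono : ∑ n ∈ B₁, ‖R₂ n‖ ^ 2 ≤ ∑ n ∈ Finset.Icc 1 ⌊X⌋₊, ‖R₂ n‖ ^ 2 :=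
    Finset.sum_le_sum_of_subset_of_nonneg (Finset.filter_subset _ _) fun _ _ _ => sq_nonneg _
  have hsq : (X ^ (1 - κ)) ^ 2 = X ^ (2 - 2 * κ) := by
    rw [← Real.rpow_natCast, ← Real.rpow_mul hX.le]; ring_nf
  have hsplit : X ^ (3 - θ + η) = X ^ (1 - θ + 2 * κ + η) * X ^ (2 - 2 * κ) := by
    rw [← Real.rpow_add hX]; ring_nf
  have key : (B₁.card : ℝ) * X ^ (2 - 2 * κ) ≤ X ^ (1 - θ + 2 * κ + η) * X ^ (2 - 2 * κ) := by
    rw [← hsplit, ← hsq]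
    exact hcheb.trans (hmono.trans h)
  exact le_of_mul_le_mul_right key (Real.rpow_pos_of_pos hX _)

/-! ### The counting argument: A ∧ B(σ) bound the window -/

/-- **The counting argument** (Montgomery–Vaughan 1975, §8, p. 367; Li 2000, §6, last line:
"By (6.1)–(6.7) and Lemma 7 the assertion follows"): inputs A and B(σ) give at most `C X^σ` even
`n ∈ ((1-ε)X, X]` that are not sums of two primes, for `X ≥ X₀`. Indeed an even `n` in the window
with `|R₂(n)| ≤ X^{1-κ} < Re R₁(n)` has `R(n) > 0` by (3.1), hence is `p₁ + p₂`; the two failure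
sets have sizes `≤ X^{1-θ+2κ+η} ≤ X^σ` (A and Chebyshev, choosing `η = σ - (1-θ+2κ) > 0`) and
`≤ C X^σ` (B). [cite: MontgomeryVaughanActa1975, §8 (8.1)–(8.3)] -/
theorem card_exceptionalWindow_le_of_arcs {σ : ℝ} (hA : minorArc_meanSquare_of_level)
    (hB : MajorArcLowerBoundOffSmallSet σ) :
    ∃ ε : ℝ, 0 < ε ∧ ε ≤ 1 / 2 ∧ ∃ C X₀ : ℝ, 0 ≤ C ∧ ∀ X : ℝ, X₀ ≤ X →
      ((exceptionalWindow ε X).card : ℝ) ≤ C * X ^ σ := by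
  obtain ⟨ε, θ, κ, hε0, hε2, hθ0, hθ4, hκ0, hσ, C, X₀, hBX⟩ := hB
  -- the loss `η` in input A is chosen so that `1 - θ + 2κ + η = σ`
  set η : ℝ := σ - (1 - θ + 2 * κ) with hη
  have hη0 : 0 < η := by rw [hη]; linarith
  obtain ⟨X₁, hAX⟩ := hA θ hθ0 hθ4 η hη0
  refine ⟨ε, hε0, hε2, max C 0 + 1, max (max X₀ X₁) 4, by positivity, fun X hX => ?_⟩
  have hXX₀ : X₀ ≤ X := ((le_max_left _ _).trans (le_max_left _ _)).trans hX
  have hXX₁ : X₁ ≤ X := ((le_max_right _ _).trans (le_max_left _ _)).trans hX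
  have hX4 : 4 ≤ X := (le_max_right _ _).trans hX
  have hX0 : 0 < X := by linarith
  -- the parameters
  set P : ℝ := X ^ θ with hP
  set Q : ℝ := X ^ (1 - θ) with hQ
  have hQ0 : 0 < Q := Real.rpow_pos_of_pos hX0 _
  have hPQ : P + 1 ≤ Q := rpow_add_one_le_rpow_one_sub hX4 hθ0.le hθ4
  -- the two bad sets
  set R₁ := fun n : ℕ => majorArcIntegral P Q X n with hR₁
  set R₂ := fun n : ℕ => minorArcIntegral P Q X n with hR₂
  set B₁ : Finset ℕ := (Finset.Icc 1 ⌊X⌋₊).filter fun n : ℕ => X ^ (1 - κ) < ‖R₂ n‖ with hB₁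
  set B₂ : Finset ℕ := (Finset.Icc 1 ⌊X⌋₊).filter fun n : ℕ =>
    (1 - ε) * X < n ∧ Even n ∧ (R₁ n).re ≤ X ^ (1 - κ) with hB₂
  have hB₁card : (B₁.card : ℝ) ≤ X ^ σ := by
    have h := card_filter_lt_norm_le_of_sum_sq_le (κ := κ) hX0 (hAX X hXX₁)
    have hexp : 1 - θ + 2 * κ + η = σ := by rw [hη]; ring
    rwa [hexp] at h
  have hB₂card : (B₂.card : ℝ) ≤ max C 0 * X ^ σ :=
    (hBX X hXX₀).trans (mul_le_mul_of_nonneg_right (le_max_left _ _) (Real.rpow_nonneg hX0.le _))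
  -- (8.1): outside `B₁ ∪ B₂` every even `n` in the window is a sum of two primes
  have hsub : exceptionalWindow ε X ⊆ B₁ ∪ B₂ := by
    intro n hn
    rw [exceptionalWindow, Finset.mem_filter] at hn
    obtain ⟨hnI, hnX, hne, hgc⟩ := hn
    rw [Finset.mem_union]
    by_contra hnot
    rw [not_or, hB₁, hB₂, Finset.mem_filter, Finset.mem_filter, not_and, not_and, not_lt] at hnot
    have hle : ‖R₂ n‖ ≤ X ^ (1 - κ) := hnot.1 hnI
    have hgt : X ^ (1 - κ) < (R₁ n).re := by
      have := hnot.2 hnI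
      by_contra hcon
      exact this ⟨hnX, hne, not_lt.mp hcon⟩
    exact goldbachCount_ne_zero_of_coeffR_ne_zero
      (coeffR_pos_of_lt X n hQ0 hPQ (hle.trans_lt hgt)).ne' hgc
  calc ((exceptionalWindow ε X).card : ℝ) ≤ ((B₁ ∪ B₂).card : ℝ) := by
        exact_mod_cast Finset.card_le_card hsub
    _ ≤ (B₁.card : ℝ) + B₂.card := by exact_mod_cast Finset.card_union_le B₁ B₂
    _ ≤ X ^ σ + max C 0 * X ^ σ := add_le_add hB₁card hB₂card
    _ = (max C 0 + 1) * X ^ σ := by ring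

end Literature.NumberTheory.Sieve.Lu2010

/-! ### Geometric summation over the windows and the final assembly -/

namespace Literature.NumberTheory.Sieve

open Lu2010

/-- Geometric summation (the step "the assertion follows", Li 2000 §6; "Then Theorem 1 is
immediate", Montgomery–Vaughan 1975 §8): if `f(x) ≤ f(g(x)) + K x^σ` for `x ≥ x₀ ≥ 1`, where the
contraction `g` satisfies `g(x) < x` and `g(x) ≤ r x` with `0 ≤ r < 1`, `σ > 0`, `K ≥ 0`, and
`f ≤ B` below `x₀`, then `f(x) ≤ M x^σ` for all `x ≥ 1`, with `M = max(B, 0) + K / (1 - r^σ)`.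
(`le_mul_rpow_of_dyadic` is the case `g(x) = ⌊x/2⌋`, `r = 1/2`.) [folklore] -/
theorem le_mul_rpow_of_contraction {f : ℕ → ℝ} {g : ℕ → ℕ} {σ K B r : ℝ} {x₀ : ℕ} (hσ : 0 < σ)
    (hK : 0 ≤ K) (hr0 : 0 ≤ r) (hr1 : r < 1) (hx₀ : 1 ≤ x₀) (hB : ∀ x, x < x₀ → f x ≤ B)
    (hg : ∀ x, x₀ ≤ x → g x < x ∧ (g x : ℝ) ≤ r * x)
    (hrec : ∀ x, x₀ ≤ x → f x ≤ f (g x) + K * (x : ℝ) ^ σ) :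
    ∃ M : ℝ, 0 ≤ M ∧ ∀ x : ℕ, 1 ≤ x → f x ≤ M * (x : ℝ) ^ σ := by
  set ρ : ℝ := r ^ σ with hρ
  have hρ0 : 0 ≤ ρ := Real.rpow_nonneg hr0 _
  have hρ1 : ρ < 1 := Real.rpow_lt_one hr0 hr1 hσ
  have hKρ : 0 ≤ K / (1 - ρ) := div_nonneg hK (by linarith)
  have hKle : K ≤ K / (1 - ρ) := by
    rw [le_div_iff₀ (by linarith)]
    nlinarith
  set M : ℝ := max B 0 + K / (1 - ρ) with hM
  have hM0 : 0 ≤ M := add_nonneg (le_max_right _ _) hKρ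
  have hKM : K ≤ M * (1 - ρ) := by
    have : K / (1 - ρ) ≤ M := le_add_of_nonneg_left (le_max_right _ _)
    rwa [div_le_iff₀ (by linarith)] at this
  have hBM : max B 0 + K ≤ M := by rw [hM]; linarith
  refine ⟨M, hM0, fun x => ?_⟩
  induction x using Nat.strong_induction_on with
  | _ x ih =>
    intro hx1
    have hxpos : (0 : ℝ) < x := by exact_mod_cast hx1
    have hxσ : 1 ≤ (x : ℝ) ^ σ := Real.one_le_rpow (by exact_mod_cast hx1) hσ.le
    have hxσ0 : 0 ≤ (x : ℝ) ^ σ := by linarith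
    rcases lt_or_ge x x₀ with hlt | hge
    · calc f x ≤ B := hB x hlt
        _ ≤ M := (le_max_left _ _).trans (le_add_of_nonneg_right hKρ)
        _ ≤ M * (x : ℝ) ^ σ := le_mul_of_one_le_right hM0 hxσ
    · obtain ⟨hgx, hgr⟩ := hg x hge
      rcases Nat.lt_or_ge (g x) 1 with hg0 | hg1
      · -- `g x = 0 < x₀`: use the bound below `x₀`
        have hfg : f (g x) ≤ max B 0 := (hB (g x) (by omega)).trans (le_max_left _ _)
        calc f x ≤ f (g x) + K * (x : ℝ) ^ σ := hrec x hge
          _ ≤ max B 0 + K * (x : ℝ) ^ σ := by linarith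
          _ ≤ max B 0 * (x : ℝ) ^ σ + K * (x : ℝ) ^ σ := by
              have := le_mul_of_one_le_right (le_max_right B 0) hxσ
              linarith
          _ = (max B 0 + K) * (x : ℝ) ^ σ := by ring
          _ ≤ M * (x : ℝ) ^ σ := mul_le_mul_of_nonneg_right hBM hxσ0
      · have ih' : f (g x) ≤ M * ((g x : ℕ) : ℝ) ^ σ := ih (g x) hgx hg1
        have hpow : ((g x : ℕ) : ℝ) ^ σ ≤ ρ * (x : ℝ) ^ σ := by
          calc ((g x : ℕ) : ℝ) ^ σ ≤ (r * x) ^ σ :=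
                Real.rpow_le_rpow (Nat.cast_nonneg _) hgr hσ.le
            _ = ρ * (x : ℝ) ^ σ := by rw [Real.mul_rpow hr0 hxpos.le, hρ]
        calc f x ≤ f (g x) + K * (x : ℝ) ^ σ := hrec x hge
          _ ≤ M * ((g x : ℕ) : ℝ) ^ σ + K * (x : ℝ) ^ σ := by linarith
          _ ≤ M * (ρ * (x : ℝ) ^ σ) + K * (x : ℝ) ^ σ := by gcongr
          _ = (M * ρ + K) * (x : ℝ) ^ σ := by ring
          _ ≤ M * (x : ℝ) ^ σ := by
              apply mul_le_mul_of_nonneg_right _ hxσ0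
              nlinarith

/-- `E(x) ≤ E(⌊(1-ε)x⌋) + #{even n ∈ ((1-ε)x, x] : n is not a sum of two primes}`: an exceptional
`N ≤ x` either satisfies `N ≤ ⌊(1-ε)x⌋` or lies in the window `((1-ε)x, x]` (Li 2000, §6, last
line; Montgomery–Vaughan 1975, §8). [cite: Li2000, §6] -/
theorem goldbachExceptionalCount_le_contraction_add (ε : ℝ) (x : ℕ) :
    goldbachExceptionalCount x ≤
      goldbachExceptionalCount ⌊(1 - ε) * x⌋₊ + (exceptionalWindow ε (x : ℝ)).card := by
  classical
  rw [goldbachExceptionalCount, goldbachExceptionalCount]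
  refine (Finset.card_le_card fun N hN => ?_).trans (Finset.card_union_le _ _)
  rw [Finset.mem_filter, Finset.mem_range] at hN
  obtain ⟨hNx, hNe, hN4, hNg⟩ := hN
  rw [Finset.mem_union]
  by_cases hsmall : N ≤ ⌊(1 - ε) * x⌋₊
  · left
    exact Finset.mem_filter.mpr ⟨Finset.mem_range.mpr (Nat.lt_succ_of_le hsmall), hNe, hN4, hNg⟩
  · right
    rw [exceptionalWindow, Finset.mem_filter, Finset.mem_Icc, Nat.floor_natCast]
    exact ⟨⟨by omega, Nat.le_of_lt_succ hNx⟩, Nat.lt_of_floor_lt (not_le.mp hsmall), hNe, hNg⟩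

/-- **Assembly at exponent `σ`**: inputs A (`minorArc_meanSquare_of_level`) and B(σ)
(`MajorArcLowerBoundOffSmallSet σ`) imply `E(x) ≪ x^σ` (note `σ > 3/4`, as `θ ≤ 1/4 < 1 + 2κ`).
Proof: the counting argument
(`card_exceptionalWindow_le_of_arcs`) bounds the exceptional even `n ∈ ((1-ε)X, X]` by `C X^σ`
for `X ≥ X₀`; with `E(x) ≤ E(⌊(1-ε)x⌋) + C x^σ` (`goldbachExceptionalCount_le_contraction_add`)
and `E(x) ≤ x + 1` below `X₀`, geometric summation (`le_mul_rpow_of_contraction`, ratio `1 - ε`)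
gives `E(x) ≤ M x^σ` for `x ≥ 1` (Montgomery–Vaughan 1975, Theorem 1 from §8; Li 2000, §6).
[cite: MontgomeryVaughanActa1975, Theorem 1 and §8] -/
theorem goldbachExceptionalCount_isBigO_rpow_of_arcs {σ : ℝ}
    (hA : minorArc_meanSquare_of_level) (hB : MajorArcLowerBoundOffSmallSet σ) :
    (fun x : ℕ => (goldbachExceptionalCount x : ℝ)) =O[atTop] fun x => (x : ℝ) ^ σ := by
  have hσ : 0 < σ := by
    obtain ⟨-, θ, κ, -, -, -, hθ4, hκ0, hlt, -⟩ := hB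
    linarith
  obtain ⟨ε, hε0, hε2, C, X₀, hC0, hX₀⟩ := card_exceptionalWindow_le_of_arcs hA hB
  set x₀ : ℕ := max ⌈X₀⌉₊ 1 with hx₀
  have hx₀1 : 1 ≤ x₀ := le_max_right _ _
  set f : ℕ → ℝ := fun x => (goldbachExceptionalCount x : ℝ) with hf
  set g : ℕ → ℕ := fun x => ⌊(1 - ε) * x⌋₊ with hg
  have hB' : ∀ x, x < x₀ → f x ≤ x₀ := by
    intro x hx
    have h1 : goldbachExceptionalCount x ≤ x + 1 :=
      (Finset.card_filter_le _ _).trans (Finset.card_range _).le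
    calc f x = (goldbachExceptionalCount x : ℝ) := rfl
      _ ≤ (x + 1 : ℕ) := by exact_mod_cast h1
      _ ≤ x₀ := by exact_mod_cast hx
  have hg' : ∀ x, x₀ ≤ x → g x < x ∧ (g x : ℝ) ≤ (1 - ε) * x := by
    intro x hx
    have hx1 : (1 : ℝ) ≤ x := by exact_mod_cast hx₀1.trans hx
    have hnn : 0 ≤ (1 - ε) * (x : ℝ) := mul_nonneg (by linarith) (by linarith)
    have hle : (g x : ℝ) ≤ (1 - ε) * x := Nat.floor_le hnn
    refine ⟨?_, hle⟩
    have hlt : (g x : ℝ) < x := hle.trans_lt (by nlinarith)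
    exact_mod_cast hlt
  have hrec : ∀ x, x₀ ≤ x → f x ≤ f (g x) + C * (x : ℝ) ^ σ := by
    intro x hx
    have hxX : X₀ ≤ (x : ℝ) :=
      (Nat.le_ceil X₀).trans (by exact_mod_cast (le_max_left _ _).trans hx)
    have h1 := goldbachExceptionalCount_le_contraction_add ε x
    have h2 := hX₀ (x : ℝ) hxX
    calc f x = (goldbachExceptionalCount x : ℝ) := rfl
      _ ≤ (goldbachExceptionalCount ⌊(1 - ε) * x⌋₊ : ℝ) +
            ((exceptionalWindow ε (x : ℝ)).card : ℝ) := by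
          exact_mod_cast h1
      _ ≤ f (g x) + C * (x : ℝ) ^ σ := add_le_add le_rfl h2
  obtain ⟨M, hM0, hM⟩ := le_mul_rpow_of_contraction hσ hC0 (by linarith : (0 : ℝ) ≤ 1 - ε)
    (by linarith : (1 : ℝ) - ε < 1) hx₀1 hB' hg' hrec
  refine IsBigO.of_bound M ?_
  filter_upwards [eventually_ge_atTop 1] with x hx
  rw [Real.norm_of_nonneg (Nat.cast_nonneg _),
    Real.norm_of_nonneg (Real.rpow_nonneg (Nat.cast_nonneg _) _)]
  exact hM x hx

/-- **Assembly of Lu 2010, Theorem 1** from the two analytic inputs: the minor-arc mean square at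
level `θ` (input A, `Literature.NumberTheory.Sieve.Lu2010.minorArc_meanSquare_of_level`, textbook) and the major-arc lower
bound off an exceptional set of size `≪ X^{0.879}` (input B at `σ = 0.879`,
`Literature.NumberTheory.Sieve.Lu2010.MajorArcLowerBoundOffSmallSet 0.879`, the depth of Lu's paper, a hypothesis)
imply parity.S15 in Lu's form, `goldbachExceptionalCount_isBigO_rpow_lu` : `E(x) ≪ x^{0.879}`.
[cite: LuJNT2010, Theorem 1] -/
theorem goldbachExceptionalCount_isBigO_rpow_lu_of_arcs (hA : minorArc_meanSquare_of_level)
    (hB : MajorArcLowerBoundOffSmallSet 0.879) : goldbachExceptionalCount_isBigO_rpow_lu :=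
  goldbachExceptionalCount_isBigO_rpow_of_arcs hA hB

end Literature.NumberTheory.Sieve

/-! ### Input A from Vinogradov's estimate -/

namespace Literature.NumberTheory.Sieve.Lu2010

open MontgomeryVaughan1975

/-- **The minor-arc mean square at every level `0 < θ ≤ 1/4`** (Montgomery–Vaughan 1975, (3.2)
with `P = X^θ`, `Q = X^{1-θ}`): `∑_{n ≤ X} |R₂(n)|² ≤ (log 4) C₁² X^{3-θ} (log X)⁹` for `X ≥ 4`,
where `C₁` is the constant of (3.3)
(`Literature.NumberTheory.Sieve.MontgomeryVaughan1975.norm_expSum_le_of_mem_minorArcs`, from `vinogradov_expSum_bound`).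
The proof is that of `Literature.NumberTheory.Sieve.MontgomeryVaughan1975.minorArc_meanSquare_of_vinogradov`
(`Literature/NumberTheory/Sieve/MontgomeryVaughan1975MinorArcs.lean`) at `δ = θ/6`: Bessel's
inequality `∑ |R₂(n)|² ≤ ∫_𝔪 |S|⁴` (Vaughan (1981), (3.20)), `∫_𝔪 |S|⁴ ≤ (max_𝔪 |S|)² ∫ |S|²`,
Parseval `∫_{Q⁻¹}^{Q⁻¹+1} |S|² = ∑_{P < p ≤ X} (log p)² ≤ (log 4) X log X`, and (3.3).
[cite: MontgomeryVaughanActa1975, §3 (3.2)] -/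
theorem sum_norm_minorArcIntegral_sq_le_of_vinogradov (hV : vinogradov_expSum_bound) :
    ∃ K : ℝ, 0 ≤ K ∧ ∀ θ : ℝ, 0 < θ → θ ≤ 1 / 4 → ∀ X : ℝ, 4 ≤ X →
      ∑ n ∈ Finset.Icc 1 ⌊X⌋₊, ‖minorArcIntegral (X ^ θ) (X ^ (1 - θ)) X n‖ ^ 2 ≤
        K * X ^ (3 - θ) * Real.log X ^ 9 := by
  obtain ⟨C₁, hC₁, hsup⟩ := norm_expSum_le_of_mem_minorArcs hV
  have hl4 : 0 ≤ Real.log 4 := Real.log_nonneg (by norm_num)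
  refine ⟨Real.log 4 * C₁ ^ 2, by positivity, fun θ hθ0 hθ4 X hX => ?_⟩
  have hX0 : 0 < X := by linarith
  have hX1 : 1 ≤ X := by linarith
  have h6 : 6 * (θ / 6) = θ := by ring
  have hsupθ := hsup (θ / 6) (by positivity) (by linarith) X hX
  rw [h6] at hsupθ
  set P : ℝ := X ^ θ with hP
  set Q : ℝ := X ^ (1 - θ) with hQ
  have hP0 : 0 < P := Real.rpow_pos_of_pos hX0 _
  have hQ0 : 0 < Q := Real.rpow_pos_of_pos hX0 _
  set u : ℝ := P ^ (-(1 / 2 : ℝ)) with hu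
  set M : ℝ := C₁ * X * u * Real.log X ^ 4 with hM
  have hSle : ∀ α ∈ MontgomeryVaughan1975.minorArcs P Q, ‖expSum P X α‖ ≤ M :=
    fun α hα => hsupθ α hα
  -- Bessel on `𝔪 ⊆ [Q⁻¹, Q⁻¹ + 1]` with `F = S²`
  have hsub : MontgomeryVaughan1975.minorArcs P Q ⊆ Set.Icc Q⁻¹ (Q⁻¹ + 1) := by
    rw [add_comm]; exact fun α hα => hα.1
  have hcont : Continuous fun α : ℝ => expSum P X α ^ 2 := by
    have := continuous_expSum P X
    fun_prop
  have hB := sum_norm_sq_setIntegral_mul_fourierChar_le hsub hcont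
    ((Finset.Icc 1 ⌊X⌋₊).map Nat.castEmbedding)
  rw [Finset.sum_map] at hB
  simp only [Nat.castEmbedding_apply, Int.cast_natCast] at hB
  -- `∫_𝔪 |S|⁴ ≤ M² ∫_𝔪 |S|² ≤ M² ∫_{Q⁻¹}^{Q⁻¹+1} |S|² = M² ∑ log² p ≤ M² (log 4) X log X`
  have hmeas := MontgomeryVaughan1975.measurableSet_minorArcs P Q
  have hc2 : Continuous fun α : ℝ => ‖expSum P X α‖ ^ 2 := (continuous_expSum P X).norm.pow 2
  have hc4 : Continuous fun α : ℝ => ‖expSum P X α ^ 2‖ ^ 2 := hcont.norm.pow 2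
  have hI1 : ∫ α in MontgomeryVaughan1975.minorArcs P Q, ‖expSum P X α ^ 2‖ ^ 2 ≤
      ∫ α in MontgomeryVaughan1975.minorArcs P Q, M ^ 2 * ‖expSum P X α‖ ^ 2 := by
    refine setIntegral_mono_on (hc4.integrableOn_Icc.mono_set hsub)
      ((continuous_const.mul hc2).integrableOn_Icc.mono_set hsub) hmeas fun α hα => ?_
    have h := hSle α hα
    have h0 : 0 ≤ ‖expSum P X α‖ := norm_nonneg _
    rw [norm_pow, ← pow_mul, show 2 * 2 = 4 by rfl]
    nlinarith [pow_le_pow_left₀ h0 h 2, sq_nonneg ‖expSum P X α‖]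
  have hI2 : ∫ α in MontgomeryVaughan1975.minorArcs P Q, M ^ 2 * ‖expSum P X α‖ ^ 2 ≤
      M ^ 2 * ∑ p ∈ primeWindow P X, Real.log p ^ 2 := by
    rw [integral_const_mul, ← integral_norm_expSum_sq P X Q⁻¹,
      intervalIntegral.integral_of_le (by linarith)]
    refine mul_le_mul_of_nonneg_left (setIntegral_mono_set ?_ ?_ ?_) (sq_nonneg _)
    · exact (hc2.integrableOn_Icc (μ := volume)).mono_set Set.Ioc_subset_Icc_self
    · exact Filter.Eventually.of_forall fun α => sq_nonneg _
    · exact (show MontgomeryVaughan1975.minorArcs P Q ≤ Set.Icc Q⁻¹ (Q⁻¹ + 1) from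
        hsub).eventuallyLE.trans Ioc_ae_eq_Icc.symm.le
  have hI3 : M ^ 2 * ∑ p ∈ primeWindow P X, Real.log p ^ 2 ≤
      M ^ 2 * (Real.log 4 * X * Real.log X) :=
    mul_le_mul_of_nonneg_left (sum_primeWindow_log_sq_le hX1) (sq_nonneg _)
  -- `X² u² · X = X^{3-θ}`
  have hXu : X ^ 2 * u ^ 2 * X = X ^ (3 - θ) := by
    have hu2 : u ^ 2 = P⁻¹ := by
      rw [hu, ← Real.rpow_natCast, ← Real.rpow_mul hP0.le]
      norm_num [Real.rpow_neg_one]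
    rw [hu2, hP, Real.rpow_sub hX0, show (3 : ℝ) = ((3 : ℕ) : ℝ) by norm_num, Real.rpow_natCast,
      div_eq_mul_inv]
    ring
  calc ∑ n ∈ Finset.Icc 1 ⌊X⌋₊, ‖minorArcIntegral P Q X n‖ ^ 2
      ≤ ∫ α in MontgomeryVaughan1975.minorArcs P Q, ‖expSum P X α ^ 2‖ ^ 2 := hB
    _ ≤ M ^ 2 * (Real.log 4 * X * Real.log X) := hI1.trans (hI2.trans hI3)
    _ = Real.log 4 * C₁ ^ 2 * (X ^ 2 * u ^ 2 * X) * Real.log X ^ 9 := by rw [hM]; ring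
    _ = Real.log 4 * C₁ ^ 2 * X ^ (3 - θ) * Real.log X ^ 9 := by rw [hXu]

/-- **Input A discharged relative to Vinogradov's estimate**:
`vinogradov_expSum_bound → minorArc_meanSquare_of_level`. From
`sum_norm_minorArcIntegral_sq_le_of_vinogradov` (`K X^{3-θ} (log X)⁹`) and `(log X)⁹ = o(X^η)`
(`isLittleO_log_rpow_rpow_atTop`): `K (log X)⁹ ≤ X^η` for `X ≥ X₀(η, K)`.
[cite: VaughanHL1981, §3.2 (3.20) p. 22; Theorem 3.1 p. 19] -/
theorem minorArc_meanSquare_of_level_of_vinogradov (hV : vinogradov_expSum_bound) :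
    minorArc_meanSquare_of_level := by
  intro θ hθ0 hθ4 η hη
  obtain ⟨K, hK0, hK⟩ := sum_norm_minorArcIntegral_sq_le_of_vinogradov hV
  have hlo := (isLittleO_log_rpow_rpow_atTop ((9 : ℕ) : ℝ) hη).bound
    (show (0 : ℝ) < 1 / (K + 1) by positivity)
  obtain ⟨X₁, hX₁⟩ := Filter.eventually_atTop.mp hlo
  refine ⟨max X₁ 4, fun X hX => ?_⟩
  have hX4 : 4 ≤ X := (le_max_right _ _).trans hX
  have hXX₁ : X₁ ≤ X := (le_max_left _ _).trans hX
  have hX0 : 0 < X := by linarith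
  have hlX0 : 0 ≤ Real.log X := Real.log_nonneg (by linarith)
  have hb := hX₁ X hXX₁
  rw [Real.rpow_natCast, Real.norm_of_nonneg (pow_nonneg hlX0 _),
    Real.norm_of_nonneg (Real.rpow_nonneg hX0.le _)] at hb
  have hKl : K * Real.log X ^ 9 ≤ X ^ η := by
    have hη0 : 0 ≤ X ^ η := Real.rpow_nonneg hX0.le _
    calc K * Real.log X ^ 9 ≤ K * (1 / (K + 1) * X ^ η) := mul_le_mul_of_nonneg_left hb hK0
      _ = K / (K + 1) * X ^ η := by ring
      _ ≤ 1 * X ^ η := by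
          apply mul_le_mul_of_nonneg_right _ hη0
          rw [div_le_one (by positivity)]
          linarith
      _ = X ^ η := one_mul _
  calc ∑ n ∈ Finset.Icc 1 ⌊X⌋₊, ‖minorArcIntegral (X ^ θ) (X ^ (1 - θ)) X n‖ ^ 2
      ≤ K * X ^ (3 - θ) * Real.log X ^ 9 := hK θ hθ0 hθ4 X hX4
    _ = X ^ (3 - θ) * (K * Real.log X ^ 9) := by ring
    _ ≤ X ^ (3 - θ) * X ^ η := mul_le_mul_of_nonneg_left hKl (Real.rpow_nonneg hX0.le _)
    _ = X ^ (3 - θ + η) := by rw [← Real.rpow_add hX0]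

end Literature.NumberTheory.Sieve.Lu2010

namespace Literature.NumberTheory.Sieve

open Lu2010 MontgomeryVaughan1975

/-- **Lu 2010, Theorem 1, from Vinogradov's estimate and the major-arc input at `σ = 0.879`**:
`vinogradov_expSum_bound → MajorArcLowerBoundOffSmallSet 0.879 → goldbachExceptionalCount_isBigO_rpow_lu`
(kept for its users; superseded by `goldbachExceptionalCount_isBigO_rpow_lu_of_majorArc`, in which
Vinogradov's estimate is no longer a hypothesis). [cite: LuJNT2010, Theorem 1] -/
theorem goldbachExceptionalCount_isBigO_rpow_lu_of_vinogradov (hV : vinogradov_expSum_bound)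
    (hB : MajorArcLowerBoundOffSmallSet 0.879) : goldbachExceptionalCount_isBigO_rpow_lu :=
  goldbachExceptionalCount_isBigO_rpow_lu_of_arcs (minorArc_meanSquare_of_level_of_vinogradov hV) hB

end Literature.NumberTheory.Sieve

/-! ### Input A discharged outright

Vinogradov's estimate `vinogradov_expSum_bound` (Nathanson, GTM 164, Theorem 8.5) is proved in
`Literature/NumberTheory/Sieve/VinogradovExpSum.lean` as
`Literature.NumberTheory.Sieve.Vinogradov.vinogradov_primeExpSumLog_bound` (same statement, constant `C = 1552`), so input A
and everything conditional on it above hold unconditionally: of the two analytic inputs of the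
method only the major-arc fact B remains a hypothesis. -/

namespace Literature.NumberTheory.Sieve.Lu2010

open MontgomeryVaughan1975

/-- **The minor-arc mean square at every level `0 < θ ≤ 1/4`, unconditionally**: there is an
absolute `K ≥ 0` with `∑_{n ≤ X} |R₂(n)|² ≤ K X^{3-θ} (log X)⁹` for all `0 < θ ≤ 1/4` and `X ≥ 4`
(`P = X^θ`, `Q = X^{1-θ}`; Montgomery–Vaughan 1975, (3.2), from Bessel's inequality, Parseval and
(3.3), with Vinogradov's estimate now a theorem, `Literature.NumberTheory.Sieve.Vinogradov.vinogradov_primeExpSumLog_bound`).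
[cite: MontgomeryVaughanActa1975, §3 (3.2)] -/
theorem sum_norm_minorArcIntegral_sq_le_level :
    ∃ K : ℝ, 0 ≤ K ∧ ∀ θ : ℝ, 0 < θ → θ ≤ 1 / 4 → ∀ X : ℝ, 4 ≤ X →
      ∑ n ∈ Finset.Icc 1 ⌊X⌋₊, ‖minorArcIntegral (X ^ θ) (X ^ (1 - θ)) X n‖ ^ 2 ≤
        K * X ^ (3 - θ) * Real.log X ^ 9 :=
  sum_norm_minorArcIntegral_sq_le_of_vinogradov Literature.NumberTheory.Sieve.Vinogradov.vinogradov_primeExpSumLog_bound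

/-- **Input A holds**: `minorArc_meanSquare_of_level` — for `0 < θ ≤ 1/4`, `η > 0` and
`X ≥ X₀(θ, η)`, `∑_{n ≤ X} |R₂(n)|² ≤ X^{3-θ+η}` — is a theorem, by
`minorArc_meanSquare_of_level_of_vinogradov` and the proof of Vinogradov's estimate
(`Literature.NumberTheory.Sieve.Vinogradov.vinogradov_primeExpSumLog_bound`, Nathanson, GTM 164, Theorem 8.5, p. 220).
[cite: VaughanHL1981, §3.2 (3.20) p. 22; Theorem 3.1 p. 19] -/
theorem minorArc_meanSquare_of_level_holds : minorArc_meanSquare_of_level :=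
  minorArc_meanSquare_of_level_of_vinogradov Literature.NumberTheory.Sieve.Vinogradov.vinogradov_primeExpSumLog_bound

end Literature.NumberTheory.Sieve.Lu2010

namespace Literature.NumberTheory.Sieve

open Lu2010 MontgomeryVaughan1975

/-- **`E(x) ≪ x^σ` from the major arcs alone**: for every exponent `σ`, the major-arc lower bound
off an exceptional set of size `≪ X^σ` (`MajorArcLowerBoundOffSmallSet σ`, the output of the
major-arc analysis of Chen–Pan / Li / Lu at level `X^θ`) implies
`#{N ≤ x : N even, N ≥ 4, N ≠ p + p'} ≪ x^σ`, the minor-arc input A being a theorem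
(`minorArc_meanSquare_of_level_holds`). Instances in print: `σ = 0.921` (Li 1999), `σ = 0.914`
(Li 2000, §6), `σ = 0.879` (Lu 2010, Theorem 1).
[cite: MontgomeryVaughanActa1975, Theorem 1 and §8] -/
theorem goldbachExceptionalCount_isBigO_rpow_of_majorArc {σ : ℝ}
    (hB : MajorArcLowerBoundOffSmallSet σ) :
    (fun x : ℕ => (goldbachExceptionalCount x : ℝ)) =O[atTop] fun x => (x : ℝ) ^ σ :=
  goldbachExceptionalCount_isBigO_rpow_of_arcs minorArc_meanSquare_of_level_holds hB

/-- **Lu 2010, Theorem 1, from the major-arc input alone**: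
`MajorArcLowerBoundOffSmallSet 0.879 → goldbachExceptionalCount_isBigO_rpow_lu` (`E(x) ≪ x^{0.879}`).
What remains for `goldbachExceptionalCount_isBigO_rpow_lu_holds` is a proof of the hypothesis
`Literature.NumberTheory.Sieve.Lu2010.MajorArcLowerBoundOffSmallSet 0.879` (the major arcs of Lu's paper: zero-density
estimates, Deuring–Heilbronn phenomenon, explicit zero-free regions; equivalently, by
`Literature.NumberTheory.Sieve.Lu2010.majorArcLowerBoundOffSmallSet_iff_goldbachCount`, more than `X^{1-κ}` Goldbach
representations for all but `≪ X^{0.879}` even `n ∈ ((1-ε)X, X]`). [cite: LuJNT2010, Theorem 1] -/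
theorem goldbachExceptionalCount_isBigO_rpow_lu_of_majorArc
    (hB : MajorArcLowerBoundOffSmallSet 0.879) : goldbachExceptionalCount_isBigO_rpow_lu :=
  goldbachExceptionalCount_isBigO_rpow_of_majorArc hB

end Literature.NumberTheory.Sieve
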